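import Literature.NumberTheory.Automorphic.RSLFactorGLOneMeasureIndependence
import Literature.NumberTheory.Automorphic.GL2LFactorTwistVanishing
import Literature.NumberTheory.Automorphic.TateLocalFunctionalEquation
import HarnessLib

/-!
# Existence of the local `L`-factor `L(s, π × 1)` of `GL₂ × GL₁`
# (Jacquet–Piatetski-Shapiro–Shalika 1983, Thm. 2.7 (i)–(ii), for `(n, m) = (2, 1)`;
# Jacquet–Langlands 1970, Thm. 2.18)

Topic `Literature/NumberTheory/Automorphic`; proof file (theorems only: no definition, no named
fact, no instance).  Let `F` be a non-archimedean local field, `π` a smooth representation of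
`GL₂(F)` on `V` with finite-dimensional Jacquet module `V_N`, `ψ` a continuous non-trivial
additive character, and `ν` a `GL₁(F)`-invariant Borel measure on `GL₁(F) ⧸ U₁ = Fˣ`, finite on
compacts and positive on opens.  We PROVE the two analytic inputs of JPSS Thm. 2.7 (i)–(ii) for
the `GL₂ × GL₁` zeta integrals `Ψ(s; W_v, 1) = ∫_{Fˣ} W_v(d(a,1)) |a|^{s-1/2} d^×a` against the
trivial representation of `GL₁(F)`, and deduce the EXISTENCE (and uniqueness) of the
`L`-polynomial:

* `exists_denominator_rsZeta_fin_two` — **a common denominator** (JPSS Thm. 2.7 (i)/(ii) "the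
  `Ψ` are rational with bounded denominators"; Jacquet–Langlands 1970, Prop. 2.10): there is
  `D ∈ ℂ[X]`, `D(0) = 1`, `deg D ≤ dim V_N`, with every `Ψ(s; W_v, W')` equal to
  `(Laurent)/D(q^{-s})` for `re s` large — `D` is the reversed characteristic polynomial of
  `d(ϖ, 1)` on `V_N` rescaled by `q^{1/2}`, exactly as in the pole bound
  `natDegree_le_finrank_of_hasRSLFactor` (`exists_pow_mul_sum_mul_integral_eq_eval`).
* `exists_whittakerModel_diagGL2_eq_indicator` — **the Kirillov model contains the indicator of a
  deep unit group** (Jacquet–Langlands 1970, Prop. 2.9 (i): `𝒮(Fˣ) ⊆ 𝒦(π)`; here only the one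
  function needed): for `Λ` a `ψ`-Whittaker functional and `v ∈ V` there are `M ≥ 1`, `C ≠ 0`
  and `w ∈ V` with `W_w(d(a, 1)) = C · Λ(v) · 1_{U^M}(a)`, namely the finite Fourier projection
  `w = ∑_{y ∈ R} ψ(-y) π(n(y)) v` over a set `R` of representatives of `𝔭^j / 𝔭^r`
  (`exists_finset_primePowBall_eq_biUnion`), whose torus function is
  `W_v(d(a,1)) ∑_{y ∈ R} ψ((a-1) y)` with the character sum evaluated by orthogonality
  (`sum_addChar_mul_measureReal_eq`, from `setIntegral_primePowBall_addChar_mul`).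
* `exists_rsZeta_eq_const_fin_two` — hence a datum whose zeta integral is a NON-ZERO CONSTANT
  `C Λ(v) μ'(U^M)` when `Λ(v) ≠ 0` ("`1` lies in the fractional ideal", JPSS Thm. 2.7 (ii)).
* `existsUnique_hasRSLFactor_fin_two_one` — **existence and uniqueness of `L(s, π × 1)`**: for
  `π` smooth with finite-dimensional Jacquet module and a non-zero `ψ`-Whittaker functional,
  and every invariant Radon full-support `ν`, there is a unique `P` with
  `HasRSLFactor (1<2) π 1 ψ ν P` (`existsUnique_hasRSLFactor_of_denominator_of_one_mem`); in
  particular for every generic irreducible smooth representation of `GL₂(F)`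
  (`existsUnique_hasRSLFactor_smoothIrrep_fin_two`, with
  `finiteDimensional_coinvariants_smoothIrrep_fin_two`).  This is the `(2, 1)`-case of the
  named fact `existsUnique_hasRSLFactor` of `RankinSelbergLocal` (with the four measure
  hypotheses that fact forgot to bind), i.e. Jacquet–Langlands 1970, Thm. 2.18: the Mellin
  transforms of the Kirillov functions of `π` span a fractional ideal `L(s, π) ℂ[q^{∓s}]`.

## References

* H. Jacquet, I. I. Piatetski-Shapiro, J. Shalika, *Rankin–Selberg convolutions*, Amer. J. Math.
  105 (1983), §2.4, Thm. 2.7 (i)–(ii). [JacquetPiatetskiShapiroShalika1983]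
* H. Jacquet, R. P. Langlands, *Automorphic forms on GL(2)*, LNM 114 (1970), Props. 2.9, 2.10,
  Thm. 2.18. [JacquetLanglands1970]
* R. Godement, *Notes on Jacquet–Langlands' theory*, IAS (1970), §1.2–1.3.
* J. Tate, *Fourier analysis in number fields and Hecke's zeta-functions* (1950), §2.5 (the
  orthogonality integrals). [Tate1950]
-/

noncomputable section

open scoped MatrixGroups NNReal ENNReal
open MeasureTheory ValuativeRel Polynomial Filter
  Literature.NumberTheory.GaloisRepresentations.IsNonarchimedeanLocalField

namespace Literature.NumberTheory.Automorphic

/-! ### Part 1: a ball is a finite disjoint union of translates of a smaller ball -/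

section Cosets

variable {F : Type*} [Field F] [ValuativeRel F] [TopologicalSpace F] [IsNonarchimedeanLocalField F]

/-- **`𝔭^j = ⨆_{y ∈ R} (y + 𝔭^r)` for a finite set `R` of representatives** (`j ≤ r`): the
image of the compact ball `𝔭^j` in the discrete quotient `F ⧸ 𝔭^r` is finite; take
`Quotient.out` of each class.  The translates are written `{x | x - y ∈ 𝔭^r}` and distinct
representatives are incongruent modulo `𝔭^r`. [folklore] -/
theorem exists_finset_primePowBall_eq_biUnion {j r : ℤ} (hjr : j ≤ r) :
    ∃ R : Finset F, (↑R : Set F) ⊆ primePowBall F j ∧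
      (∀ y ∈ R, ∀ y' ∈ R, y ≠ y' → y - y' ∉ primePowBall F r) ∧
      primePowBall F j = ⋃ y ∈ R, {x : F | x - y ∈ primePowBall F r} := by
  classical
  let H : AddSubgroup F :=
    { carrier := primePowBall F r
      add_mem' := fun hx hy => add_mem_primePowBall hx hy
      zero_mem' := zero_mem_primePowBall r
      neg_mem' := fun hx => neg_mem_primePowBall hx }
  have hHmem : ∀ x : F, x ∈ H ↔ x ∈ primePowBall F r := fun x => Iff.rfl
  have hHo : IsOpen (H : Set F) := isOpen_primePowBall r
  haveI : DiscreteTopology (F ⧸ H) := QuotientAddGroup.discreteTopology hHo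
  have hmk : Continuous (QuotientAddGroup.mk : F → F ⧸ H) := continuous_quot_mk
  have hfin : ((QuotientAddGroup.mk : F → F ⧸ H) '' primePowBall F j).Finite :=
    ((isCompact_primePowBall j).image hmk).finite_of_discrete
  -- `x - out [x] ∈ 𝔭^r`
  have hout : ∀ x : F, x - Quotient.out (QuotientAddGroup.mk x : F ⧸ H) ∈ primePowBall F r := by
    intro x
    have h : (QuotientAddGroup.mk (Quotient.out (QuotientAddGroup.mk x : F ⧸ H)) : F ⧸ H) =
        QuotientAddGroup.mk x := QuotientAddGroup.out_eq' _
    have h' := QuotientAddGroup.eq.1 h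
    rw [hHmem, neg_add_eq_sub] at h'
    exact h'
  have hrj : primePowBall F r ⊆ primePowBall F j := primePowBall_antitone hjr
  refine ⟨hfin.toFinset.image Quotient.out, ?_, ?_, ?_⟩
  · intro y hy
    obtain ⟨c, hc, rfl⟩ := Finset.mem_image.1 hy
    obtain ⟨x, hx, rfl⟩ := hfin.mem_toFinset.1 hc
    have h := hout x
    have : Quotient.out (QuotientAddGroup.mk x : F ⧸ H) = x + -(x - Quotient.out (QuotientAddGroup.mk x : F ⧸ H)) := by
      ring
    rw [this]
    exact add_mem_primePowBall hx (neg_mem_primePowBall (hrj h))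
  · intro y hy y' hy' hne hmem
    obtain ⟨c, -, rfl⟩ := Finset.mem_image.1 hy
    obtain ⟨c', -, rfl⟩ := Finset.mem_image.1 hy'
    apply hne
    have h1 : (QuotientAddGroup.mk (Quotient.out c') : F ⧸ H) = QuotientAddGroup.mk (Quotient.out c) := by
      refine QuotientAddGroup.eq.2 ?_
      rw [hHmem, neg_add_eq_sub]
      exact hmem
    rw [QuotientAddGroup.out_eq', QuotientAddGroup.out_eq'] at h1
    rw [h1]
  · ext x
    simp only [Set.mem_iUnion, Set.mem_setOf_eq, Finset.mem_image,
      Set.Finite.mem_toFinset, Set.mem_image, exists_prop]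
    constructor
    · intro hx
      exact ⟨Quotient.out (QuotientAddGroup.mk x : F ⧸ H), ⟨QuotientAddGroup.mk x, ⟨x, hx, rfl⟩, rfl⟩,
        hout x⟩
    · rintro ⟨_, ⟨c, ⟨x', hx', rfl⟩, rfl⟩, hxy⟩
      have hy : Quotient.out (QuotientAddGroup.mk x' : F ⧸ H) ∈ primePowBall F j := by
        have h := hout x'
        have : Quotient.out (QuotientAddGroup.mk x' : F ⧸ H) =
            x' + -(x' - Quotient.out (QuotientAddGroup.mk x' : F ⧸ H)) := by ring
        rw [this]
        exact add_mem_primePowBall hx' (neg_mem_primePowBall (hrj h))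
      have : x = (x - Quotient.out (QuotientAddGroup.mk x' : F ⧸ H)) +
          Quotient.out (QuotientAddGroup.mk x' : F ⧸ H) := by ring
      rw [this]
      exact add_mem_primePowBall (hrj hxy) hy

variable [MeasurableSpace F] [BorelSpace F]

open scoped Classical in
/-- **Orthogonality over the representatives.**  For `ψ` continuous of conductor exponent `m`,
`𝔭^j = ⨆_{y ∈ R} (y + 𝔭^r)` as above and `b ∈ 𝔭^{m-r}` (so that `x ↦ ψ(x b)` is constant on
the translates of `𝔭^r`):
`(∑_{y ∈ R} ψ(y b)) · μ(𝔭^r) = ∫_{𝔭^j} ψ(x b) dμ(x) = μ(𝔭^j) · [b ∈ 𝔭^{m-j}]`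
(`setIntegral_primePowBall_addChar_mul`; Tate 1950, §2.5). [cite: Tate1950, §2.5] -/
theorem sum_addChar_mul_measureReal_eq (μ : Measure F) [μ.IsAddHaarMeasure]
    {ψ : AddChar F Circle} (hψc : Continuous ψ) {m : ℤ} (hm : ψ.HasConductorExp m) {j r : ℤ}
    {R : Finset F} (hdisj : ∀ y ∈ R, ∀ y' ∈ R, y ≠ y' → y - y' ∉ primePowBall F r)
    (hU : primePowBall F j = ⋃ y ∈ R, {x : F | x - y ∈ primePowBall F r})
    {b : F} (hb : b ∈ primePowBall F (m - r)) :
    (∑ y ∈ R, (ψ (y * b) : ℂ)) * (μ.real (primePowBall F r) : ℂ) =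
      if b ∈ primePowBall F (m - j) then (μ.real (primePowBall F j) : ℂ) else 0 := by
  classical
  rw [← setIntegral_primePowBall_addChar_mul μ hm j b, hU]
  have hmeas : ∀ y ∈ R, MeasurableSet {x : F | x - y ∈ primePowBall F r} := fun y _ =>
    (measurableSet_primePowBall r).preimage (measurable_sub_const y)
  have hset : ∀ y : F, {x : F | x - y ∈ primePowBall F r} = (fun h => -y + h) ⁻¹' primePowBall F r := by
    intro y; ext x; simp [neg_add_eq_sub]
  have hμ : ∀ y : F, μ {x : F | x - y ∈ primePowBall F r} = μ (primePowBall F r) := fun y => by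
    rw [hset, measure_preimage_add]
  have hdisj' : Set.Pairwise (↑R : Set F)
      (Function.onFun Disjoint fun y => {x : F | x - y ∈ primePowBall F r}) := by
    intro y hy y' hy' hne
    refine Set.disjoint_left.2 fun x hx hx' => hdisj y hy y' hy' hne ?_
    have : y - y' = (x - y') + -(x - y) := by ring
    rw [this]
    exact add_mem_primePowBall hx' (neg_mem_primePowBall hx)
  have hcont : Continuous fun x : F => (ψ (x * b) : ℂ) :=
    continuous_subtype_val.comp (hψc.comp (continuous_id.mul continuous_const))
  have hint : ∀ y ∈ R, IntegrableOn (fun x : F => (ψ (x * b) : ℂ))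
      {x : F | x - y ∈ primePowBall F r} μ := by
    intro y _
    refine Measure.integrableOn_of_bounded (M := 1) ?_ hcont.aestronglyMeasurable
      (Filter.Eventually.of_forall fun x => ?_)
    · rw [hμ]
      exact (isCompact_primePowBall r).measure_lt_top.ne
    · rw [Circle.norm_coe]
  rw [integral_biUnion_finset R hmeas hdisj' hint, Finset.sum_mul]
  refine Finset.sum_congr rfl fun y _ => ?_
  -- on `y + 𝔭^r` the character is constant `= ψ(y b)`
  have hEq : Set.EqOn (fun x : F => (ψ (x * b) : ℂ)) (fun _ => (ψ (y * b) : ℂ))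
      {x : F | x - y ∈ primePowBall F r} := by
    intro x hx
    have hxy : (x - y) * b ∈ primePowBall F m := by
      have := mul_mem_primePowBall hx hb
      rwa [add_sub_cancel] at this
    simp only
    rw [show x * b = (x - y) * b + y * b by ring, AddChar.map_add_eq_mul, Circle.coe_mul,
      hm.1 _ hxy, Circle.coe_one, one_mul]
  rw [setIntegral_congr_fun (hmeas y (by assumption)) hEq, setIntegral_const, Complex.real_smul,
    measureReal_def, measureReal_def, hμ, mul_comm]

end Cosets

/-! ### Part 2: the Kirillov model contains the indicator of a deep unit group -/

section Indicator

variable {F : Type*} [Field F] [ValuativeRel F] [TopologicalSpace F] [IsNonarchimedeanLocalField F]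
  {V : Type*} [AddCommGroup V] [Module ℂ V] (π : Representation ℂ (GL (Fin 2) F) V)

omit [ValuativeRel F] [TopologicalSpace F] [IsNonarchimedeanLocalField F] in
/-- Torus function of a finite Fourier combination of unipotent translates:
`W_{∑ c_y π(n(y)) v}(d(a,1)) = (∑ c_y ψ(a y)) · W_v(d(a,1))`. [folklore] -/
theorem whittakerModel_sum_unipotentGL2_diagGL2 {ψ : AddChar F Circle} {Λ : Module.Dual ℂ V}
    (hΛ : Λ ∈ whittakerFunctionals π ψ) (v : V) (R : Finset F) (c : F → ℂ) (a : Fˣ) :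
    whittakerModel π Λ (∑ y ∈ R, c y • π ((unipotentGL2 y : ↥(upperUnitriangular (Fin 2) F)) :
        GL (Fin 2) F) v) (diagGL2 a 1) =
      (∑ y ∈ R, c y * (ψ ((a : F) * y) : ℂ)) * whittakerModel π Λ v (diagGL2 a 1) := by
  rw [map_sum, Finset.sum_apply, Finset.sum_mul]
  refine Finset.sum_congr rfl fun y _ => ?_
  rw [map_smul, Pi.smul_apply, smul_eq_mul, whittakerModel_unipotentGL2_diagGL2 π hΛ v a y, mul_assoc]

/-- A smooth vector is fixed by `d(u, 1)` for `u` in some `U^N`, `N ≥ 1`. [folklore] -/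
theorem exists_unitFiltration_diagGL2_apply_eq {v : V} (hv : π.IsSmoothVector v) :
    ∃ N : ℕ, 1 ≤ N ∧ ∀ u ∈ unitFiltration F N, π (diagGL2 u 1) v = v := by
  have hpre : (fun a : Fˣ => (diagGL2 a 1 : GL (Fin 2) F)) ⁻¹' (π.stabilizerSubgroup v : Set _) ∈
      nhds (1 : Fˣ) := by
    refine (continuous_unitsDiagGL2_one (F := F)).continuousAt.preimage_mem_nhds ?_
    have h1 : (π.stabilizerSubgroup v : Set (GL (Fin 2) F)) ∈
        nhds ((fun a : Fˣ => (diagGL2 a 1 : GL (Fin 2) F)) 1) := by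
      simp only [diagGL2_one]
      exact hv.mem_nhds (π.stabilizerSubgroup v).one_mem
    exact h1
  obtain ⟨N, hN1, hN⟩ := exists_unitFiltration_subset hpre
  exact ⟨N, hN1, fun u hu => hN hu⟩

variable [MeasurableSpace F] [BorelSpace F]

omit [BorelSpace F] in
/-- `μ(𝔭^k) > 0` is a non-zero real number for an additive Haar measure. [folklore] -/
theorem measureReal_primePowBall_ne_zero (μ : Measure F) [μ.IsAddHaarMeasure] (k : ℤ) :
    μ.real (primePowBall F k) ≠ 0 :=
  (ENNReal.toReal_pos ((isOpen_primePowBall k).measure_ne_zero μ ⟨0, zero_mem_primePowBall k⟩)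
    (isCompact_primePowBall k).measure_lt_top.ne).ne'

omit [MeasurableSpace F] [BorelSpace F] in
/-- `1 ∈ 𝔭^k` for `k ≤ 0`. [folklore] -/
theorem one_mem_primePowBall_of_nonpos {k : ℤ} (hk : k ≤ 0) : (1 : F) ∈ primePowBall F k := by
  rw [mem_primePowBall_iff, map_one]
  exact (one_le_zpow_iff_right_of_lt_one₀ inv_residueFieldCard_pos inv_residueFieldCard_lt_one).2 hk

/-- **The Kirillov model contains `Λ(v) · 1_{U^M}`** (Jacquet–Langlands 1970, Prop. 2.9 (i),
the one instance needed here).  Let `ψ` be continuous non-trivial, `Λ` a `ψ`-Whittaker functional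
and `v` a smooth vector.  There are `M ≥ 1`, a constant `C ≠ 0` and a vector `w` (a finite
Fourier combination `∑_{y ∈ R} ψ(-y) π(n(y)) v`, `R` a set of representatives of `𝔭^j / 𝔭^r`
for suitable `j ≤ r`) with `W_w(d(a, 1)) = C · Λ(v) · 1_{U^M}(a)` for all `a ∈ Fˣ`: indeed
`W_w(d(a,1)) = W_v(d(a,1)) ∑_y ψ((a-1)y)`, the sum is `(μ(𝔭^j)/μ(𝔭^r)) [a - 1 ∈ 𝔭^M]`
on the support of `W_v(d(·,1))` (`sum_addChar_mul_measureReal_eq`), and `W_v(d(a,1)) = Λ(v)` for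
`a ∈ U^M` once `d(U^M, 1)` fixes `v`. [cite: JacquetLanglands1970, Prop. 2.9 (i)] -/
theorem exists_whittakerModel_diagGL2_eq_indicator {ψ : AddChar F Circle}
    (hψ : ψ.IsContinuousNontrivial) {Λ : Module.Dual ℂ V} (hΛ : Λ ∈ whittakerFunctionals π ψ)
    {v : V} (hv : π.IsSmoothVector v) :
    ∃ (w : V) (M : ℕ) (C : ℂ), 1 ≤ M ∧ C ≠ 0 ∧ ∀ a : Fˣ,
      whittakerModel π Λ w (diagGL2 a 1) =
        C * Λ v * (unitFiltration F M).indicator (fun _ => (1 : ℂ)) a := by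
  classical
  haveI : T2Space F :=
    (Literature.NumberTheory.GaloisRepresentations.IsNonarchimedeanLocalField.isLocalField F).toT2Space
  -- an additive Haar measure, the conductor of `ψ`, the support of `W_v` and the depth of `v`
  set μ : Measure F := Measure.addHaar with hμ
  obtain ⟨m, hm⟩ := hψ.exists_hasConductorExp
  obtain ⟨k, hk⟩ := exists_whittakerModel_diagGL2_eq_zero_of_not_mem π hψ hΛ hv
  obtain ⟨M, hM1, hM⟩ := exists_unitFiltration_diagGL2_apply_eq π hv
  -- the balls: support `⊆ 𝔭^{k₁}` with `k₁ ≤ 0`, `j = m - M`, `r = max j (m - k₁)`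
  set k₁ : ℤ := min k 0 with hk₁
  have hk₁0 : k₁ ≤ 0 := min_le_right _ _
  have hsupp : ∀ a : Fˣ, (a : F) ∉ primePowBall F k₁ → whittakerModel π Λ v (diagGL2 a 1) = 0 :=
    fun a ha => hk a fun h => ha (primePowBall_antitone (min_le_left _ _) h)
  set j : ℤ := m - M with hj
  set r : ℤ := max j (m - k₁) with hr
  obtain ⟨R, -, hdisj, hU⟩ :=
    exists_finset_primePowBall_eq_biUnion (F := F) (le_max_left j (m - k₁) : j ≤ r)
  -- the vector and the constant
  set w : V := ∑ y ∈ R, ((ψ (-y) : ℂ)) •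
    π ((unipotentGL2 y : ↥(upperUnitriangular (Fin 2) F)) : GL (Fin 2) F) v with hw
  set C : ℂ := (μ.real (primePowBall F j) : ℂ) * ((μ.real (primePowBall F r) : ℂ))⁻¹ with hC
  have hμr : (μ.real (primePowBall F r) : ℂ) ≠ 0 :=
    Complex.ofReal_ne_zero.2 (measureReal_primePowBall_ne_zero μ r)
  have hCne : C ≠ 0 :=
    mul_ne_zero (Complex.ofReal_ne_zero.2 (measureReal_primePowBall_ne_zero μ j)) (inv_ne_zero hμr)
  refine ⟨w, M, C, hM1, hCne, fun a => ?_⟩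
  -- the torus function of `w`
  have hsum : whittakerModel π Λ w (diagGL2 a 1) =
      (∑ y ∈ R, (ψ (y * ((a : F) - 1)) : ℂ)) * whittakerModel π Λ v (diagGL2 a 1) := by
    rw [hw, whittakerModel_sum_unipotentGL2_diagGL2 π hΛ v R (fun y => (ψ (-y) : ℂ)) a]
    congr 1
    refine Finset.sum_congr rfl fun y _ => ?_
    rw [← Circle.coe_mul, ← AddChar.map_add_eq_mul]
    congr 2
    ring
  by_cases ha : (a : F) ∈ primePowBall F k₁
  · -- on the support: evaluate the character sum by orthogonality
    have hb : (a : F) - 1 ∈ primePowBall F (m - r) := by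
      have h1 : (a : F) - 1 ∈ primePowBall F k₁ := by
        rw [sub_eq_add_neg]
        exact add_mem_primePowBall ha (neg_mem_primePowBall (one_mem_primePowBall_of_nonpos hk₁0))
      exact primePowBall_antitone (by rw [hr]; have := le_max_right j (m - k₁); omega) h1
    have hchar := sum_addChar_mul_measureReal_eq μ hψ.1 hm hdisj hU hb
    -- `[a - 1 ∈ 𝔭^{m - j}] = [a ∈ U^M]`
    have hmj : m - j = (M : ℤ) := by rw [hj]; ring
    rw [hmj] at hchar
    by_cases hu : a ∈ unitFiltration F M
    · have h1 : (a : F) - 1 ∈ primePowBall F (M : ℤ) := (mem_unitFiltration_iff_sub_one_mem hM1 a).1 hu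
      rw [if_pos h1] at hchar
      -- `W_v(d(a,1)) = Λ v` since `d(a, 1)` fixes `v`
      have hva : whittakerModel π Λ v (diagGL2 a 1) = Λ v := by
        have h := whittakerModel_diagGL2_diagGL2 π Λ v 1 a
        rw [hM a hu, one_mul] at h
        rw [← h, whittakerModel_apply, diagGL2_one, map_one, Module.End.one_apply]
      have hS : (∑ y ∈ R, (ψ (y * ((a : F) - 1)) : ℂ)) = C := by
        rw [hC, eq_mul_inv_iff_mul_eq₀ hμr, hchar]
      rw [hsum, hS, hva, Set.indicator_of_mem hu, mul_one]
    · have h1 : (a : F) - 1 ∉ primePowBall F (M : ℤ) := fun h =>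
        hu ((mem_unitFiltration_iff_sub_one_mem hM1 a).2 h)
      rw [if_neg h1, mul_eq_zero] at hchar
      have hS : (∑ y ∈ R, (ψ (y * ((a : F) - 1)) : ℂ)) = 0 := hchar.resolve_right hμr
      rw [hsum, hS, zero_mul, Set.indicator_of_notMem hu, mul_zero]
  · -- off the support both sides vanish
    have h0 : whittakerModel π Λ v (diagGL2 a 1) = 0 := hsupp a ha
    have ha' : a ∉ unitFiltration F M := by
      intro hu
      apply ha
      have h1 : (a : F) - 1 ∈ primePowBall F (M : ℤ) := (mem_unitFiltration_iff_sub_one_mem hM1 a).1 hu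
      have : (a : F) = ((a : F) - 1) + 1 := by ring
      rw [this]
      exact add_mem_primePowBall (primePowBall_antitone (by omega) h1)
        (one_mem_primePowBall_of_nonpos hk₁0)
    rw [hsum, h0, mul_zero, Set.indicator_of_notMem ha', mul_zero]

end Indicator

/-! ### Part 3: a datum whose zeta integral is a non-zero constant -/

section Constant

variable {F : Type*} [Field F] [ValuativeRel F] [TopologicalSpace F] [IsNonarchimedeanLocalField F]
  {V : Type*} [AddCommGroup V] [Module ℂ V] (π : Representation ℂ (GL (Fin 2) F) V)
  [MeasurableSpace F] [BorelSpace F]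
  [MeasurableSpace (GL (Fin 1) F ⧸ upperUnitriangular (Fin 1) F)]

/-- **`1` lies in the fractional ideal of the `GL₂ × GL₁` zeta integrals** (JPSS 1983,
Thm. 2.7 (ii); Jacquet–Langlands 1970, proof of Thm. 2.18): for a `ψ`-Whittaker functional `Λ`
and a smooth `v` there is `w ∈ V` whose zeta integrals against the constant Whittaker functions of
the trivial representation of `GL₁(F)` are the CONSTANTS `c · Λ(v) · Λ'(v')` with `c ≠ 0`
(`c = C μ'(U^M)` for the vector of `exists_whittakerModel_diagGL2_eq_indicator`).
[cite: JacquetPiatetskiShapiroShalika1983, Thm. 2.7 (ii)] -/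
theorem exists_rsZeta_eq_const_fin_two (μ' : Measure Fˣ) [μ'.IsHaarMeasure]
    (ν : Measure (GL (Fin 1) F ⧸ upperUnitriangular (Fin 1) F))
    (hint : ∀ f : GL (Fin 1) F ⧸ upperUnitriangular (Fin 1) F → ℂ,
      ∫ x, f x ∂ν = ∫ a : Fˣ, f (QuotientGroup.mk (glDiagonal 1 F fun _ => a)) ∂μ')
    {ψ : AddChar F Circle} (hψ : ψ.IsContinuousNontrivial) {Λ : Module.Dual ℂ V}
    (hΛ : Λ ∈ whittakerFunctionals π ψ) {v : V} (hv : π.IsSmoothVector v) :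
    ∃ (w : V) (c : ℂ), c ≠ 0 ∧ ∀ (Λ' : Module.Dual ℂ ℂ) (v' : ℂ) (s : ℂ),
      rsZeta Nat.one_lt_two ν (whittakerModel π Λ w)
        (whittakerModel (Representation.trivial ℂ (GL (Fin 1) F) ℂ) Λ' v') s = c * Λ v * Λ' v' := by
  haveI : BorelSpace Fˣ := Units.borelSpace
  obtain ⟨w, M, C, hM1, hCne, hw⟩ := exists_whittakerModel_diagGL2_eq_indicator π hψ hΛ hv
  refine ⟨w, C * (μ'.real (unitFiltration F M) : ℂ),
    mul_ne_zero hCne (Complex.ofReal_ne_zero.2 (measureReal_unitFiltration_ne_zero μ' hM1)),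
    fun Λ' v' s => ?_⟩
  have hW' : ∀ g, whittakerModel (Representation.trivial ℂ (GL (Fin 1) F) ℂ) Λ' v' g = Λ' v' :=
    fun g => whittakerModel_trivial_apply _ _ g
  rw [rsZeta_eq_integral_torus μ' ν hint (whittakerModel π Λ w) hW' s]
  have hfun : (fun a : Fˣ => whittakerModel π Λ w (diagGL2 a 1) * Λ' v' *
      (((normAbs F (a : F) : ℝ≥0) : ℝ) : ℂ) ^ (s - 1 / 2)) =
      (unitFiltration F M).indicator fun a => C * Λ v * Λ' v' *
        (((normAbs F (a : F) : ℝ≥0) : ℝ) : ℂ) ^ (s - 1 / 2) := by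
    funext a
    rw [hw a]
    by_cases ha : a ∈ unitFiltration F M
    · rw [Set.indicator_of_mem ha, Set.indicator_of_mem ha, mul_one]
    · rw [Set.indicator_of_notMem ha, Set.indicator_of_notMem ha, mul_zero, zero_mul, zero_mul]
  have hEq : Set.EqOn (fun a : Fˣ => C * Λ v * Λ' v' * (((normAbs F (a : F) : ℝ≥0) : ℝ) : ℂ) ^ (s - 1 / 2))
      (fun _ => C * Λ v * Λ' v') (unitFiltration F M) := by
    intro a ha
    simp only
    rw [ha.1, NNReal.coe_one, Complex.ofReal_one, Complex.one_cpow, mul_one]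
  rw [hfun, integral_indicator (measurableSet_unitFiltration hM1),
    setIntegral_congr_fun (measurableSet_unitFiltration hM1) hEq, setIntegral_const, Complex.real_smul]
  ring

end Constant

/-! ### Part 4: the common denominator -/

section Denominator

variable {F : Type*} [Field F] [ValuativeRel F] [TopologicalSpace F] [IsNonarchimedeanLocalField F]
  {V : Type*} [AddCommGroup V] [Module ℂ V] (π : Representation ℂ (GL (Fin 2) F) V)
  [MeasurableSpace F] [BorelSpace F]
  [MeasurableSpace (GL (Fin 1) F ⧸ upperUnitriangular (Fin 1) F)]

/-- **A common denominator for the `GL₂ × GL₁` zeta integrals** (Jacquet–Langlands 1970,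
Prop. 2.10; JPSS 1983, Thm. 2.7 (i)–(ii), "bounded denominators").  Let `π` be smooth with
finite-dimensional Jacquet module `V_N`, `ψ` continuous non-trivial and `ν` the transport of a Haar
measure `μ'` of `Fˣ`.  There is `D ∈ ℂ[X]` with `D(0) = 1`, `deg D ≤ dim V_N`, such that every
`Ψ(s; W_v, W')` (`W_v` a `ψ`-Whittaker function of `π`, `W'` a constant Whittaker function of the
trivial representation of `GL₁(F)`) agrees for `re s` large with `R(q^{-s}) / D(q^{-s})`, `R` a
Laurent polynomial: `D(X) = ∑ᵢ qᵢ (q^{1/2} X)^{d-i}` for the characteristic polynomial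
`Q = ∑ qᵢ Yⁱ` of `d(ϖ, 1)` on `V_N` (`exists_monic_forall_sum_coeff_mul_whittakerModel_eq_zero`,
`exists_pow_mul_sum_mul_integral_eq_eval`). [cite: JacquetLanglands1970, Prop. 2.10] -/
theorem exists_denominator_rsZeta_fin_two (μ' : Measure Fˣ) [μ'.IsHaarMeasure]
    (ν : Measure (GL (Fin 1) F ⧸ upperUnitriangular (Fin 1) F))
    (hint : ∀ f : GL (Fin 1) F ⧸ upperUnitriangular (Fin 1) F → ℂ,
      ∫ x, f x ∂ν = ∫ a : Fˣ, f (QuotientGroup.mk (glDiagonal 1 F fun _ => a)) ∂μ')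
    (hπ : π.IsSmooth) {ψ : AddChar F Circle} (hψ : ψ.IsContinuousNontrivial)
    [FiniteDimensional ℂ (Representation.restrictUnipotentGL F (id : Fin 2 → Fin 2) π).Coinvariants] :
    ∃ D : ℂ[X], D.eval 0 = 1 ∧
      D.natDegree ≤ Module.finrank ℂ (Representation.restrictUnipotentGL F (id : Fin 2 → Fin 2) π).Coinvariants ∧
      ∀ Λ ∈ whittakerFunctionals π ψ, ∀ (Λ' : Module.Dual ℂ ℂ) (v : V) (v' : ℂ),
        ∃ R : RatFunc ℂ, IsLaurent R ∧ EqOnRightHalfPlane (residueFieldCard F)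
          (rsZeta Nat.one_lt_two ν (whittakerModel π Λ v)
            (whittakerModel (Representation.trivial ℂ (GL (Fin 1) F) ℂ) Λ' v')) (R * rsLRat D) := by
  classical
  haveI : T2Space F :=
    (Literature.NumberTheory.GaloisRepresentations.IsNonarchimedeanLocalField.isLocalField F).toT2Space
  haveI : BorelSpace Fˣ := Units.borelSpace
  set q : ℕ := residueFieldCard F with hq_def
  have hq : 1 < q := one_lt_residueFieldCard F
  -- a uniformiser and the recursion polynomial `Q` of `d(ϖ, 1)` on all of `V_N`
  obtain ⟨ϖ₀, hϖ₀0, hϖ₀⟩ := exists_normAbs_eq_inv (F := F)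
  set ϖ : Fˣ := Units.mk0 ϖ₀ hϖ₀0 with hϖ_def
  have hϖ : normAbs F (ϖ : F) = (residueFieldCard F : ℝ≥0)⁻¹ := hϖ₀
  obtain ⟨Q, hQm, hQd, hQ⟩ := exists_monic_forall_sum_coeff_mul_whittakerModel_eq_zero π hψ ϖ ⊤
    (fun _ _ => Submodule.mem_top)
  -- the constants `α = q^{1/2}`, `X = q^{-s}`, `Y = α X`
  have hr0 : (0 : ℝ) < (((residueFieldCard F : ℝ≥0)⁻¹ : ℝ≥0) : ℝ) := by
    exact_mod_cast inv_residueFieldCard_pos (F := F)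
  set α : ℂ := ((((residueFieldCard F : ℝ≥0)⁻¹ : ℝ≥0) : ℝ) : ℂ) ^ (-(1 / 2 : ℂ)) with hα
  have hα0 : α ≠ 0 := by
    rw [hα, Ne, Complex.cpow_eq_zero_iff, not_and_or]
    exact Or.inl (by exact_mod_cast hr0.ne')
  have hY : ∀ s : ℂ, ((((residueFieldCard F : ℝ≥0)⁻¹ : ℝ≥0) : ℝ) : ℂ) ^ (s - 1 / 2) =
      α * (q : ℂ) ^ (-s) := by
    intro s
    have hxq : ((((residueFieldCard F : ℝ≥0)⁻¹ : ℝ≥0) : ℝ) : ℂ) = ((residueFieldCard F : ℂ))⁻¹ := by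
      rw [NNReal.coe_inv, NNReal.coe_natCast, Complex.ofReal_inv, Complex.ofReal_natCast]
    have hxne : ((((residueFieldCard F : ℝ≥0)⁻¹ : ℝ≥0) : ℝ) : ℂ) ≠ 0 := Complex.ofReal_ne_zero.2 hr0.ne'
    have hxs' : ((((residueFieldCard F : ℝ≥0)⁻¹ : ℝ≥0) : ℝ) : ℂ) ^ s = (residueFieldCard F : ℂ) ^ (-s) := by
      rw [hxq, Complex.inv_cpow _ _ (by rw [Complex.natCast_arg]; exact Real.pi_ne_zero.symm),
        Complex.cpow_neg]
    rw [show s - 1 / 2 = -(1 / 2 : ℂ) + s by ring, Complex.cpow_add _ _ hxne, hxs']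
  -- `D(X) = ∑ Q.coeff i · α^{d-i} X^{d-i}`
  obtain ⟨d, hd⟩ : ∃ d : ℕ, Q.natDegree = d := ⟨_, rfl⟩
  simp only [hd] at hQ
  have hcd : Q.coeff d = 1 := by rw [← hd]; exact hQm.coeff_natDegree
  set D : ℂ[X] := ∑ i ∈ Finset.range (d + 1), C (Q.coeff i * α ^ (d - i)) * X ^ (d - i) with hD_def
  have hDeval : ∀ x : ℂ, D.eval x = ∑ i ∈ Finset.range (d + 1), Q.coeff i * (α * x) ^ (d - i) := by
    intro x
    rw [hD_def, Polynomial.eval_finsetSum]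
    refine Finset.sum_congr rfl fun i _ => ?_
    rw [Polynomial.eval_mul, Polynomial.eval_C, Polynomial.eval_pow, Polynomial.eval_X, mul_pow,
      mul_assoc]
  have hD0 : D.eval 0 = 1 := by
    rw [hDeval, Finset.sum_eq_single d, hcd, Nat.sub_self, pow_zero, mul_one]
    · intro i hi hid
      have h : d - i ≠ 0 := by have := Finset.mem_range.1 hi; omega
      rw [mul_zero, zero_pow h, mul_zero]
    · intro h; exact absurd (Finset.mem_range.2 (Nat.lt_succ_self d)) h
  have hDne : D ≠ 0 := fun h => by rw [h, Polynomial.eval_zero] at hD0; exact zero_ne_one hD0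
  have hDdeg : D.natDegree ≤ d := by
    rw [hD_def]
    refine Polynomial.natDegree_sum_le_of_forall_le _ _ fun i _ => ?_
    exact (Polynomial.natDegree_C_mul_X_pow_le _ _).trans (Nat.sub_le d i)
  refine ⟨D, hD0, hDdeg.trans (by rw [← hd, hQd, finrank_top]), fun Λ hΛ Λ' v v' => ?_⟩
  -- the relation `X^K D(X) Ψ(s) = p̃(X)` on a right half-plane
  have hW' : ∀ g, whittakerModel (Representation.trivial ℂ (GL (Fin 1) F) ℂ) Λ' v' g = Λ' v' :=
    fun g => whittakerModel_trivial_apply _ _ g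
  obtain ⟨kr, hkr⟩ := hQ hΛ v Submodule.mem_top
  obtain ⟨k₁, hk₁⟩ := exists_whittakerModel_diagGL2_eq_zero_of_not_mem π hψ hΛ (hπ v)
  have hcv : Continuous fun a : Fˣ => whittakerModel π Λ v (diagGL2 a 1) :=
    (isLocallyConstant_whittakerModel_diagGL2 π Λ (hπ v)).continuous
  obtain ⟨K, p, σ₀, hKp⟩ := exists_pow_mul_sum_mul_integral_eq_eval μ'
    (Φ := fun a : Fˣ => whittakerModel π Λ v (diagGL2 a 1)) hcv hk₁ hϖ (c := fun j => Q.coeff j) hcd hkr (Λ' v')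
  set pt : ℂ[X] := Polynomial.C (α ^ K)⁻¹ * p.comp (Polynomial.C α * X) with hpt
  have hrel : ∀ s : ℂ, σ₀ < s.re →
      ((q : ℂ) ^ (-s)) ^ K * D.eval ((q : ℂ) ^ (-s)) *
        rsZeta Nat.one_lt_two ν (whittakerModel π Λ v)
          (whittakerModel (Representation.trivial ℂ (GL (Fin 1) F) ℂ) Λ' v') s =
      pt.eval ((q : ℂ) ^ (-s)) := by
    intro s hs
    have hz := rsZeta_eq_integral_torus μ' ν hint (whittakerModel π Λ v) hW' s
    have hK := hKp s hs
    rw [hY s, mul_pow, ← hDeval] at hK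
    rw [hz, hpt, Polynomial.eval_mul, Polynomial.eval_C, Polynomial.eval_comp, Polynomial.eval_mul,
      Polynomial.eval_C, Polynomial.eval_X, ← hK]
    simp only [mul_assoc]
    rw [inv_mul_cancel_left₀ (pow_ne_zero K hα0)]
  clear_value pt
  -- the Laurent numerator `R = p̃ / X^K`
  refine ⟨algebraMap ℂ[X] (RatFunc ℂ) pt / RatFunc.X ^ K, ⟨pt, K, rfl⟩, ?_⟩
  have hXD : (X : ℂ[X]) ^ K * D ≠ 0 := mul_ne_zero (pow_ne_zero _ Polynomial.X_ne_zero) hDne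
  have hRD : algebraMap ℂ[X] (RatFunc ℂ) pt / RatFunc.X ^ K * rsLRat D =
      algebraMap ℂ[X] (RatFunc ℂ) pt / algebraMap ℂ[X] (RatFunc ℂ) ((X : ℂ[X]) ^ K * D) := by
    rw [rsLRat, ← div_eq_mul_inv, div_div, map_mul (algebraMap ℂ[X] (RatFunc ℂ)) ((X : ℂ[X]) ^ K) D,
      map_pow, RatFunc.algebraMap_X]
  rw [eqOnRightHalfPlane_iff]
  filter_upwards [eventually_rightHalfPlanes_iff.2 ⟨σ₀, fun s hs => hs⟩,
    eventually_eval_qpow_ne_zero hq hXD] with s hs hne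
  rw [hRD, evalAtQ_div_of_eval_ne_zero (residueFieldCard F) pt ((X : ℂ[X]) ^ K * D) hne,
    eq_div_iff hne, ← hrel s hs, Polynomial.eval_mul, Polynomial.eval_pow, Polynomial.eval_X]
  ring

end Denominator

/-! ### Part 5: existence and uniqueness of `L(s, π × 1)` -/

section Existence

variable {F : Type*} [Field F] [ValuativeRel F] [TopologicalSpace F] [IsNonarchimedeanLocalField F]
  {V : Type*} [AddCommGroup V] [Module ℂ V] (π : Representation ℂ (GL (Fin 2) F) V)
  [MeasurableSpace F] [BorelSpace F]
  [MeasurableSpace (GL (Fin 1) F ⧸ upperUnitriangular (Fin 1) F)]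
  [BorelSpace (GL (Fin 1) F ⧸ upperUnitriangular (Fin 1) F)]

/-- `RatFunc.C a` is a Laurent polynomial. [folklore] -/
theorem isLaurent_ratFuncC (a : ℂ) : IsLaurent (RatFunc.C a) :=
  ⟨Polynomial.C a, 0, by rw [pow_zero, div_one, RatFunc.algebraMap_C]⟩

/-- **Existence and uniqueness of the `GL₂ × GL₁` `L`-factor `L(s, π × 1) = 1/P(q^{-s})`**
(Jacquet–Piatetski-Shapiro–Shalika 1983, Thm. 2.7 (i)–(ii) for `(n, m) = (2, 1)`;
Jacquet–Langlands 1970, Thm. 2.18).  Let `π` be a smooth representation of `GL₂(F)` with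
finite-dimensional Jacquet module, `ψ` continuous non-trivial, `Λ ≠ 0` a `ψ`-Whittaker
functional, and `ν` a `GL₁(F)`-invariant Borel measure on `GL₁(F) ⧸ U₁`, finite on compacts and
positive on opens.  Then there is a unique polynomial `P` (`P(0) = 1`) with
`HasRSLFactor (1<2) π 1 ψ ν P`: the zeta integrals have the common denominator `D` of
`exists_denominator_rsZeta_fin_two` and `1` is a constant multiple of one of them
(`exists_rsZeta_eq_const_fin_two`), so `existsUnique_hasRSLFactor_of_denominator_of_one_mem`
applies. [cite: JacquetPiatetskiShapiroShalika1983, Thm. 2.7 (i)–(ii)]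
[cite: JacquetLanglands1970, Thm. 2.18] -/
theorem existsUnique_hasRSLFactor_fin_two_one (hπ : π.IsSmooth) {ψ : AddChar F Circle}
    (hψ : ψ.IsContinuousNontrivial)
    [FiniteDimensional ℂ (Representation.restrictUnipotentGL F (id : Fin 2 → Fin 2) π).Coinvariants]
    {Λ : Module.Dual ℂ V} (hΛ : Λ ∈ whittakerFunctionals π ψ) (hΛ0 : Λ ≠ 0)
    (ν : Measure (GL (Fin 1) F ⧸ upperUnitriangular (Fin 1) F))
    [SMulInvariantMeasure (GL (Fin 1) F) (GL (Fin 1) F ⧸ upperUnitriangular (Fin 1) F) ν]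
    [IsFiniteMeasureOnCompacts ν] [ν.IsOpenPosMeasure] :
    ∃! P : ℂ[X], HasRSLFactor Nat.one_lt_two π (Representation.trivial ℂ (GL (Fin 1) F) ℂ) ψ ν P := by
  obtain ⟨μ', hμ', hint⟩ := exists_isHaarMeasure_integral_eq ν
  haveI := hμ'
  obtain ⟨D, hD0, -, hden⟩ := exists_denominator_rsZeta_fin_two π μ' ν hint hπ hψ
  have hDne : D ≠ 0 := fun h => by rw [h, Polynomial.eval_zero] at hD0; exact zero_ne_one hD0
  -- a vector on which `Λ` does not vanish
  obtain ⟨v, hv⟩ : ∃ v : V, Λ v ≠ 0 := by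
    by_contra h
    push Not at h
    exact hΛ0 (LinearMap.ext h)
  obtain ⟨w, c, hc, hw⟩ := exists_rsZeta_eq_const_fin_two π μ' ν hint hψ hΛ (hπ v)
  refine existsUnique_hasRSLFactor_of_denominator_of_one_mem hDne
    (fun L hL L' _ x x' => hden L hL L' x x') ?_
  refine ⟨1, fun _ => Λ, fun _ => LinearMap.id, fun _ => w, fun _ => 1,
    fun _ => RatFunc.C (c * Λ v)⁻¹, fun _ => hΛ, fun _ => ?_, fun _ => isLaurent_ratFuncC _,
    ⟨0, fun s _ => ?_⟩⟩
  · rw [whittakerFunctionals_eq_top_of_fin_one]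
    trivial
  · simp only [Fin.sum_univ_one, evalAtQ_C, hw, LinearMap.id_apply, evalAtQ_one]
    field_simp

/-- **`L(s, π × 1)` exists for every generic irreducible smooth representation of `GL₂(F)`**
(Jacquet–Langlands 1970, Thm. 2.18; JPSS 1983, Thm. 2.7 (i)–(ii) for `(2, 1)`): for
`π` irreducible smooth and `ψ`-generic, `ψ` continuous non-trivial and `ν` invariant Radon of full
support on `GL₁(F) ⧸ U₁`, there is a unique `P` with `HasRSLFactor (1<2) π 1 ψ ν P` — the
Jacquet module is finite-dimensional by `finiteDimensional_coinvariants_smoothIrrep_fin_two`.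
[cite: JacquetLanglands1970, Thm. 2.18] [cite: JacquetPiatetskiShapiroShalika1983, Thm. 2.7 (i)–(ii)] -/
theorem existsUnique_hasRSLFactor_smoothIrrep_fin_two (πv : SmoothIrrep (GL (Fin 2) F))
    {ψ : AddChar F Circle} (hψ : ψ.IsContinuousNontrivial) (hgen : IsGeneric πv.ρ ψ)
    (ν : Measure (GL (Fin 1) F ⧸ upperUnitriangular (Fin 1) F))
    [SMulInvariantMeasure (GL (Fin 1) F) (GL (Fin 1) F ⧸ upperUnitriangular (Fin 1) F) ν]
    [IsFiniteMeasureOnCompacts ν] [ν.IsOpenPosMeasure] :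
    ∃! P : ℂ[X], HasRSLFactor Nat.one_lt_two πv.ρ (Representation.trivial ℂ (GL (Fin 1) F) ℂ) ψ ν P := by
  haveI := (finiteDimensional_coinvariants_smoothIrrep_fin_two πv).1
  obtain ⟨Λ, hΛ, hΛ0⟩ := (isGeneric_iff _ _).1 hgen
  exact existsUnique_hasRSLFactor_fin_two_one πv.ρ πv.isSmooth hψ hΛ hΛ0 ν

end Existence



end Literature.NumberTheory.Automorphic

end
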